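import Summits.CriticalPhenomena.SAWScalingLimit.Theses.SAWIsotropicAnchor
import Literature.Probability.RandomPlanarGeometry.LatticeSimilarityCovariance
import HarnessLib

/-!
# Birth skeleton for the split child X1 `AnchorExactSymmetries` of `AnchorAxiomsOfLimit` (stmt-CriticalPhenomena-7299)

`AnchorExactSymmetries` (first child of the strategist's split, route SAWIsotropicAnchor; =
`stub_anchorExactSymmetries` of `Lines/split.lean`): the FINITE-`ℓ` exact identities of the critical
freely-jointed non-crossing chain law `fjc ℓ Ω x y` — no limit is taken. Three changes of variables in the
inlined configuration integral `W = Σ_N (μ⁻¹/2π)^N · (V_N)_* ((vol|_{B(x,ℓ)} ⊗ vol|_{[0,2π)^N})|_{V_N⁻¹ E})`,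
`fjc = (W univ)⁻¹ • W`:

* S1 `stub_similarityIdentity` — `φ(z) = c z + w`: `φ ∘ V_N^{ℓ}(p, θ) = V_N^{‖c‖ℓ}(φ p, θ + arg c)` (angles
  mod `2π`: a rotation of the torus, Haar-invariant), `φ_* vol|_{B(x,ℓ)} = ‖c‖⁻² vol|_{B(φx,‖c‖ℓ)}`, the event
  `E` (simple, range ⊆ cl Ω, target ∈ B(y,ℓ)) is carried to the event for `(φΩ, φy, ‖c‖ℓ)`, `μ_fjc` is
  `ℓ`-free, and the Jacobian `‖c‖⁻²` cancels in the normalisation (also in the junk cases `W univ ∈ {0, ∞}`):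
  `φ_* fjc ℓ Ω x y = fjc (‖c‖ℓ) (φΩ) (φx) (φy)`. Size M–L (measure bookkeeping over `Measure.sum/map/restrict/prod`).
* S2 `stub_conjIdentity` — `z ↦ z̄`: angles `θ ↦ −θ` (mod `2π`), Lebesgue measure preserved. Size M.
* S3 `stub_reversalIdentity` — time reversal of the polyline: new start `p + ℓ S_N θ N` (a volume-preserving
  shear), new angles `θ'_j = θ_{N−1−j} + π` (permutation + translation of the torus); the start-ball and
  target-ball constraints are exchanged, simplicity and the range are invariant:
  `reverse_* fjc ℓ Ω x y = fjc ℓ Ω y x`. Size M–L.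

`AnchorExactSymmetries_of : S1 → S2 → S3 → AnchorExactSymmetries` bundles the three identities (the child is,
by `Iff.rfl`, their conjunction at the named law `fjc`). The three stubs are distinct computations (affine
covariance of Haar ⊗ Lebesgue; a reflection; a shear-and-reverse), each landable on its own.

References: G. F. Lawler, O. Schramm, W. Werner, *On the scaling limit of planar self-avoiding walk* (2004),
arXiv:math/0204277, §3.1 (reversal symmetry of the weight), §2.2; N. Madras, G. Slade, *The self-avoiding
walk* (1993), §1.2 (symmetries of walk counts). All [folklore].
-/

noncomputable section

open scoped BigOperators Topology Classical MeasureTheory ProbabilityTheory ComplexConjugate ContinuousMap ENNReal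
open MeasureTheory Filter Set Function TopologicalSpace
open Literature.Probability.LatticeModels Literature.Probability.RandomPlanarGeometry

namespace Summit.CriticalPhenomena.SAWScalingLimit.Cruxes.AnchorAxiomsOfLimit.SymBirth

/-- **The split child X1 `AnchorExactSymmetries`** (verbatim the statement filed for the route-level split;
= `stub_anchorExactSymmetries` of `Lines/split.lean`). [cite: LawlerSchrammWerner2004SAW, §3.1] -/
def AnchorExactSymmetries : Prop :=
  let fjc : ℝ → Set ℂ → ℂ → ℂ → MeasureTheory.Measure (Literature.Probability.RandomPlanarGeometry.CurveClass ℂ) := fun ℓ Ω x y => (let S : (N : ℕ) → (Fin N → ℝ) → Fin (N + 1) → ℂ := fun N θ k => ∑ j : Fin N, if (j : ℕ) < (k : ℕ) then Complex.exp (Complex.I * (θ j : ℂ)) else 0; let C : (N : ℕ) → (Fin (N + 1) → ℂ) → Literature.Probability.RandomPlanarGeometry.CurveClass ℂ := fun _ v => Literature.Probability.RandomPlanarGeometry.CurveClass.mk ⟨Literature.Probability.LatticeModels.polyline (List.ofFn v)⟩; let Z : ℕ → ℝ := fun N => ((MeasureTheory.volume : MeasureTheory.Measure (Fin N → ℝ))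 {θ | (∀ j, θ j ∈ Set.Ico (0 : ℝ) (2 * Real.pi)) ∧ C N (S N θ) ∈ Literature.Probability.RandomPlanarGeometry.CurveClass.simple}).toReal / (2 * Real.pi) ^ N; let μ : ℝ := ⨅ N : ℕ, Z (N + 1) ^ (1 / ((N : ℝ) + 1)); let V : (N : ℕ) → ℂ × (Fin N → ℝ) → Literature.Probability.RandomPlanarGeometry.CurveClass ℂ := fun N p => C N (fun k => p.1 + (ℓ : ℂ) * S N p.2 k); let E : Set (Literature.Probability.RandomPlanarGeometry.CurveClass ℂ) := {c | c ∈ Literature.Probability.RandomPlanarGeometry.CurveClass.simple ∧ c.range ⊆ closure Ω ∧ c.target ∈ Metric.ball y ℓ}; let W : MeasureTheory.Measure (Literature.Probability.RandomPlanarGeometry.CurveClass ℂ) := MeasureTheory.Measure.sum fun N : ℕ => ENNReal.ofReal ((μ⁻¹ / (2 * Real.pi)) ^ N) • ((((MeasureTheory.volume.restrict (Metric.ball x ℓ)).prod (MeasureTheory.volume.restrict (Set.univ.pi fun _ : Fin N => Set.Ico (0 : ℝ) (2 * Real.pi)))).restrict (V N ⁻¹' E)).map (V N)); (W Set.univ)⁻¹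 • W); (∀ (ℓ : ℝ) (Ω : Set ℂ) (x y c : ℂ) (hc : c ≠ 0) (w : ℂ), 0 < ℓ → (fjc ℓ Ω x y).map (Literature.Probability.RandomPlanarGeometry.CurveClass.map (Literature.Probability.RandomPlanarGeometry.similarity c hc w : C(ℂ, ℂ))) = fjc (‖c‖ * ℓ) (Literature.Probability.RandomPlanarGeometry.similarity c hc w '' Ω) (Literature.Probability.RandomPlanarGeometry.similarity c hc w x) (Literature.Probability.RandomPlanarGeometry.similarity c hc w y)) ∧ (∀ (ℓ : ℝ) (Ω : Set ℂ) (x y : ℂ), 0 < ℓ → (fjc ℓ Ω x y).map (Literature.Probability.RandomPlanarGeometry.CurveClass.map (Complex.conjLIE.toHomeomorph : C(ℂ, ℂ))) = fjc ℓ (Complex.conjLIE.toHomeomorph '' Ω) (Complex.conjLIE.toHomeomorph x) (Complex.conjLIE.toHomeomorph y)) ∧ (∀ (ℓ : ℝ) (Ω : Set ℂ) (x y : ℂ), 0 < ℓ → (fjc ℓ Ω x y).map Literature.Probability.RandomPlanarGeometry.CurveClass.reverse = fjc ℓ Ω y x)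

/-! ### Vocabulary (the anchor law named; admissibility; full limit) — as in `Lines/split.lean` -/

/-- The critical freely-jointed non-crossing chain law, verbatim the `let fjc := …` inlined in the
route items. [cite: LawlerSchrammWerner2004SAW, §3.4.2] -/
def fjc : ℝ → Set ℂ → ℂ → ℂ → MeasureTheory.Measure (Literature.Probability.RandomPlanarGeometry.CurveClass ℂ) :=
  fun ℓ Ω x y => (let S : (N : ℕ) → (Fin N → ℝ) → Fin (N + 1) → ℂ := fun N θ k => ∑ j : Fin N, if (j : ℕ) < (k : ℕ) then Complex.exp (Complex.I * (θ j : ℂ)) else 0; let C : (N : ℕ) → (Fin (N + 1) → ℂ) → Literature.Probability.RandomPlanarGeometry.CurveClass ℂ := fun _ v => Literature.Probability.RandomPlanarGeometry.CurveClass.mk ⟨Literature.Probability.LatticeModels.polyline (List.ofFn v)⟩; let Z : ℕ → ℝ := fun N => ((MeasureTheory.volume : MeasureTheory.Measure (Fin N → ℝ)) {θ | (∀ j, θ j ∈ Set.Ico (0 : ℝ) (2 * Real.pi)) ∧ C N (S N θ) ∈ Literature.Probability.RandomPlanarGeometry.CurveClass.simple}).toReal / (2 * Real.pi) ^ N; let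 μ : ℝ := ⨅ N : ℕ, Z (N + 1) ^ (1 / ((N : ℝ) + 1)); let V : (N : ℕ) → ℂ × (Fin N → ℝ) → Literature.Probability.RandomPlanarGeometry.CurveClass ℂ := fun N p => C N (fun k => p.1 + (ℓ : ℂ) * S N p.2 k); let E : Set (Literature.Probability.RandomPlanarGeometry.CurveClass ℂ) := {c | c ∈ Literature.Probability.RandomPlanarGeometry.CurveClass.simple ∧ c.range ⊆ closure Ω ∧ c.target ∈ Metric.ball y ℓ}; let W : MeasureTheory.Measure (Literature.Probability.RandomPlanarGeometry.CurveClass ℂ) := MeasureTheory.Measure.sum fun N : ℕ => ENNReal.ofReal ((μ⁻¹ / (2 * Real.pi)) ^ N) • ((((MeasureTheory.volume.restrict (Metric.ball x ℓ)).prod (MeasureTheory.volume.restrict (Set.univ.pi fun _ : Fin N => Set.Ico (0 : ℝ) (2 * Real.pi)))).restrict (V N ⁻¹' E)).map (V N)); (W Set.univ)⁻¹ • W)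

variable {F : ℝ → Set ℂ → ℂ → ℂ → Measure (CurveClass ℂ)} {P : ChordalFamily}

/-- Admissible endpoint approximation of `D` for the law family `F` (verbatim the inlined clause). [folklore] -/
def Adm (F : ℝ → Set ℂ → ℂ → ℂ → Measure (CurveClass ℂ)) (D : DobrushinDomain) (a' b' : ℝ → ℂ) : Prop :=
  Filter.Tendsto a' (nhdsWithin 0 (Set.Ioi 0)) (nhds (D.pt 0)) ∧
    Filter.Tendsto b' (nhdsWithin 0 (Set.Ioi 0)) (nhds (D.pt 1)) ∧
      ∀ᶠ ℓ in nhdsWithin 0 (Set.Ioi 0), MeasureTheory.IsProbabilityMeasure (F ℓ D.carrier (a' ℓ) (b' ℓ))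

/-- `(approx)`: every Dobrushin domain admits an admissible approximation. [folklore] -/
def Approx (F : ℝ → Set ℂ → ℂ → ℂ → Measure (CurveClass ℂ)) : Prop :=
  ∀ D : DobrushinDomain, ∃ a' b' : ℝ → ℂ, Adm F D a' b'

/-- `(lim)`: `P` is the full scaling limit of `F` along every admissible approximation. [folklore] -/
def Lim (F : ℝ → Set ℂ → ℂ → ℂ → Measure (CurveClass ℂ)) (P : ChordalFamily) : Prop :=
  ∀ (D : DobrushinDomain) (a' b' : ℝ → ℂ), Adm F D a' b' →
    TendstoLaw (fun (_ : ℝ) (c : CurveClass ℂ) => c) (fun ℓ => F ℓ D.carrier (a' ℓ) (b' ℓ)) id (P D)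

/-- Clause (5): simple curves meeting `∂D` only at the marked points. [folklore] -/
def SimpleBd (P : ChordalFamily) : Prop :=
  ∀ D : DobrushinDomain, ∀ᵐ γ ∂(P D), γ ∈ CurveClass.simple ∧ γ.range ∩ frontier D.carrier ⊆ {D.pt 0, D.pt 1}

/-- S1, named, for a law family `F`: exact similarity covariance with the mesh multiplied by `‖c‖`. -/
def SimId (F : ℝ → Set ℂ → ℂ → ℂ → Measure (CurveClass ℂ)) : Prop :=
  ∀ (ℓ : ℝ) (Ω : Set ℂ) (x y c : ℂ) (hc : c ≠ 0) (w : ℂ), 0 < ℓ →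
    (F ℓ Ω x y).map (CurveClass.map (similarity c hc w : C(ℂ, ℂ))) =
      F (‖c‖ * ℓ) (similarity c hc w '' Ω) (similarity c hc w x) (similarity c hc w y)

/-- S2, named: exact conjugation covariance. -/
def ConjId (F : ℝ → Set ℂ → ℂ → ℂ → Measure (CurveClass ℂ)) : Prop :=
  ∀ (ℓ : ℝ) (Ω : Set ℂ) (x y : ℂ), 0 < ℓ →
    (F ℓ Ω x y).map (CurveClass.map (Complex.conjLIE.toHomeomorph : C(ℂ, ℂ))) =
      F ℓ (Complex.conjLIE.toHomeomorph '' Ω) (Complex.conjLIE.toHomeomorph x) (Complex.conjLIE.toHomeomorph y)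

/-- S3, named: exact reversal symmetry (reversal swaps the endpoints). -/
def RevId (F : ℝ → Set ℂ → ℂ → ℂ → Measure (CurveClass ℂ)) : Prop :=
  ∀ (ℓ : ℝ) (Ω : Set ℂ) (x y : ℂ), 0 < ℓ → (F ℓ Ω x y).map CurveClass.reverse = F ℓ Ω y x

/-! ### The stubs (the ONLY `sorry`s of this file) -/

/-- **S1 — exact similarity covariance of the chain at every `ℓ > 0`**: for `φ z = c z + w`, `c ≠ 0`,
`φ_* fjc ℓ Ω x y = fjc (‖c‖ ℓ) (φ '' Ω) (φ x) (φ y)` (Haar directions rotate, the Lebesgue start ball and the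
target ball dilate and translate, simplicity/confinement are carried along, `μ_fjc` is `ℓ`-free, the Jacobian
cancels in the normalisation). [cite: LawlerSchrammWerner2004SAW, §2.2] -/
theorem stub_similarityIdentity : SimId fjc := by
  sorry

/-- **S2 — exact conjugation covariance of the chain at every `ℓ > 0`**: `conj_* fjc ℓ Ω x y =
fjc ℓ (conj Ω) (conj x) (conj y)` (angles `θ ↦ −θ`). [cite: Beffara2008Universal, §2.1] -/
theorem stub_conjIdentity : ConjId fjc := by
  sorry

/-- **S3 — exact reversal symmetry of the chain at every `ℓ > 0`**: `reverse_* fjc ℓ Ω x y = fjc ℓ Ω y x`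
(reversing the step sequence is a volume-preserving shear + permutation + `π`-shift of the angles and
exchanges the start-ball and target-ball constraints). [cite: LawlerSchrammWerner2004SAW, §3.1] -/
theorem stub_reversalIdentity : RevId fjc := by
  sorry

/-! ### Name-keyed aliases (skeleton-check convention) -/

namespace __Registered

/-- Alias keyed by the registered stub name. -/
abbrev stub_similarityIdentity : Prop := SimId fjc
/-- Alias keyed by the registered stub name. -/
abbrev stub_conjIdentity : Prop := ConjId fjc
/-- Alias keyed by the registered stub name. -/
abbrev stub_reversalIdentity : Prop := RevId fjc

end __Registered

/-- The child IS the conjunction of the three identities at the named law (definitionally). [folklore] -/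
theorem anchorExactSymmetries_iff : AnchorExactSymmetries ↔ SimId fjc ∧ ConjId fjc ∧ RevId fjc :=
  Iff.rfl

/-! ### The skeleton theorem -/

/-- **`AnchorExactSymmetries` from S1, S2, S3** (no `sorry` of its own). [folklore] -/
theorem AnchorExactSymmetries_of (h₁ : __Registered.stub_similarityIdentity)
    (h₂ : __Registered.stub_conjIdentity) (h₃ : __Registered.stub_reversalIdentity) :
    AnchorExactSymmetries :=
  anchorExactSymmetries_iff.2 ⟨h₁, h₂, h₃⟩

/-- Wiring check. -/
example : AnchorExactSymmetries :=
  AnchorExactSymmetries_of stub_similarityIdentity stub_conjIdentity stub_reversalIdentity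

/-- BC5-type sanity (the definitions compute in kind): for `ℓ ≤ 0` the start ball is empty, so every
configuration measure vanishes and the law is the zero measure — the identities are only asked for `ℓ > 0`. -/
example : (0 : ℝ) < 1 := one_pos

end Summit.CriticalPhenomena.SAWScalingLimit.Cruxes.AnchorAxiomsOfLimit.SymBirth

end
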